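import Summits.PneNP.PneNP.Theorems.PhaseTwinsMacroscopicTwinsAboveDefs
import Summits.PneNP.PneNP.Theorems.PolyDepthTwinsAbove.Negative.TseitinGapCoupling

/-!
# `MacroscopicTwinsAbove` (stmt-PneNP-2720), negative side V: the sector hypothesis of `stub_energy` is load-bearing

Support file of the crux disprover (cdisprove seat, gen 3) for the PICKED line `literal-gadgets-cfi-apparatus` of the
crux `PhaseTwins.MacroscopicTwinsAbove` (skeleton `Cruxes/MacroscopicTwinsAbove/Lines/literal-gadgets-cfi-apparatus.lean`,
definitions LANDED as `PhaseTwinsMacroscopicTwinsAboveDefs`).  The registered stub `stub_energy`, second conjunct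
(SECTOR OPTIMISATION), asserts: if every variable occurs `≤ D` times, every assignment violates `≥ t` equations of
`(E, b)`, and the pair coupling dominates, `K·D·log ρ_F ≤ κ₁·log B`, then every phase vector `Y` of the far twin,
boosted by `e^{K t (Ψ0 − Ψ1)}`, weighs at most the reference vector of the satisfiable twin:
`lgW E λ q⁺ q⁻ κ₁ K b Y · e^{K t (Ψ0−Ψ1)} ≤ lgW E λ q⁺ q⁻ κ₁ K 0 lgRef`.  Here:

* `cxWeight_strictMono` — the complex factor `F_e(λ; x)` is STRICTLY monotone in each vacancy probability for
  `λ > 0` (the singleton `{(i,a)}` is an independent set of the complex), refining `cxWeight_mono` of the sibling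
  negative file `PolyDepthTwinsAbove/Negative/TseitinGapCoupling.lean` (imported, not re-proved);
* `cxW_ref_lt_allMinus` — hence the reference pattern (`g_{·,0}` in phase `+`, `g_{·,1}` in phase `−`) is STRICTLY
  lighter than the all-`−` pattern: `F₀ < F_max`;
* `sectorOpt_false_without_coupling` — with the pair coupling switched off (`κ₁ = 0`, so the sector hypothesis is
  unavailable as soon as `K·D ≥ 1` and `ρ_F > 1`) the conclusion of `stub_energy`(ii) is FALSE for every
  `0 < λ`, `q⁻ < q⁺ < 1`, `K ≥ 1`: already for ONE variable and ONE equation `x + x + x = 0` (`D = 3`, `b = 0`,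
  `t = 0`) the all-`−` phase vector outweighs the reference vector (`F_max^K > F₀^K`).  The stub with the sector
  hypothesis deleted (everything else verbatim, universally closed) is therefore false
  (`not_sectorOptWithoutCoupling`): any proof of `stub_energy` must spend the sector hypothesis — aligned
  literal pairs have to be penalised by the pair bundles.  `sectorOpt_false_without_coupling_any` says the same for
  EVERY system with at least one equation (`lgW_ref_lt_allMinus_zero_coupling`: with `κ₁ = 0` the reference vector
  is never the heaviest).  (WITH the hypothesis the stub holds on paper and in
  exact-arithmetic brute force on all systems with `nv ≤ 3`, `m ≤ 2`: job j011053 of the cdisprove seat.)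
[folklore]
-/

noncomputable section

open scoped Classical BigOperators

set_option linter.dupNamespace false

namespace Summit.PneNP.PneNP.Theorems.MacroscopicTwinsAbove.Negative

open Summit.PneNP.PneNP.Cruxes.PolyDepthTwinsAbove.ParityWiredPorts (occP occM pairW CxVert cxGraph cxWeight cxW
  pwPsi cxRho)
open Summit.PneNP.PneNP.Cruxes.MacroscopicTwinsAbove.LiteralGadgetsCfiApparatus (lgW lgRef)
open Summit.PneNP.PneNP.Theorems.PolyDepthTwinsAbove.Negative (cxWeight_mono cxW_pos cxW_le_allMinus)

/-! ## Strict monotonicity of the complex factor -/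

/-- The product factor of the singleton `{(i,a)}` is the single vacancy `x (i,a)`. -/
theorem prod_ite_mem_singleton (z : Fin 3 × ZMod 2 → ℝ) (p₀ : Fin 3 × ZMod 2) :
    (∏ p : Fin 3 × ZMod 2, (if (Sum.inl p : CxVert) ∈ ({Sum.inl p₀} : Finset CxVert) then z p else 1)) =
      z p₀ := by
  rw [Finset.prod_eq_single p₀]
  · simp
  · intro p _ hp
    rw [if_neg]
    simpa using hp
  · intro h
    exact (h (Finset.mem_univ _)).elim

/-- **Strict monotonicity**: for `λ > 0`, raising one vacancy probability strictly (and none lowered) raises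
`F_e(λ; x)` strictly — the singleton `{(i,a)}` is an independent set of the complex. -/
theorem cxWeight_strictMono (e : ZMod 2) {lam : ℝ} (hlam : 0 < lam) {x x' : Fin 3 × ZMod 2 → ℝ}
    (hx : ∀ p, 0 ≤ x p) (hxx' : ∀ p, x p ≤ x' p) {p₀ : Fin 3 × ZMod 2} (hp₀ : x p₀ < x' p₀) :
    cxWeight e lam x < cxWeight e lam x' := by
  unfold cxWeight
  refine Finset.sum_lt_sum (fun J _ => ?_) ⟨{Sum.inl p₀}, Finset.mem_univ _, ?_⟩
  · split_ifs with hJ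
    · refine mul_le_mul_of_nonneg_left ?_ (pow_nonneg hlam.le _)
      refine Finset.prod_le_prod (fun p _ => ?_) (fun p _ => ?_)
      · split_ifs
        · exact hx p
        · exact zero_le_one
      · split_ifs
        · exact hxx' p
        · exact le_rfl
    · exact le_rfl
  · have hind : (cxGraph e).IsIndepSet (↑({Sum.inl p₀} : Finset CxVert) : Set CxVert) := by
      rw [Finset.coe_singleton, SimpleGraph.isIndepSet_iff]
      exact Set.pairwise_singleton _ _
    rw [if_pos hind, if_pos hind, Finset.card_singleton, pow_one, prod_ite_mem_singleton x p₀,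
      prod_ite_mem_singleton x' p₀]
    exact mul_lt_mul_of_pos_left hp₀ hlam

/-- **`F₀ < F_max`**: the reference pattern is STRICTLY lighter than the all-`−` pattern (vacancies
`1 − q⁺ < 1 − q⁻` at the three `+` ports). -/
theorem cxW_ref_lt_allMinus {lam qp qm : ℝ} (hlam : 0 < lam) (hlt : qm < qp) (hqp : qp < 1) :
    cxW lam qp qm 0 (fun p => decide (p.2 = 0)) < cxW lam qp qm 0 (fun _ => false) := by
  unfold cxW
  have h10 : (0 : ℝ) < (1 + lam) ^ 10 := pow_pos (by linarith) 10
  refine div_lt_div_of_pos_right ?_ h10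
  refine cxWeight_strictMono 0 hlam (fun p => ?_) (fun p => ?_) (p₀ := ((0 : Fin 3), (0 : ZMod 2))) ?_
  · show 0 ≤ 1 - occP qp qm (decide (p.2 = 0))
    by_cases hp : p.2 = 0
    · simp only [hp, decide_true, occP, if_true]; linarith
    · simp only [hp, decide_false, occP]; norm_num; linarith
  · show 1 - occP qp qm (decide (p.2 = 0)) ≤ 1 - occP qp qm false
    by_cases hp : p.2 = 0
    · simp only [hp, decide_true, occP, if_true]; norm_num; linarith
    · simp only [hp, decide_false, occP]; norm_num
  · show 1 - occP qp qm (decide (((0 : Fin 3), (0 : ZMod 2)).2 = 0)) < 1 - occP qp qm false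
    simp only [decide_true, occP, if_true]; norm_num; linarith

/-! ## The sector hypothesis is load-bearing -/

/-- With no pair coupling (`κ₁ = 0`), one variable and one equation, the weight of a phase vector is the `K`-th power
of the single complex factor. -/
theorem lgW_one_one_zero_coupling (E : Fin 1 → Fin 3 → Fin 1) (lam qp qm : ℝ) (K : ℕ) (b : Fin 1 → ZMod 2)
    (Y : Fin 1 × ZMod 2 → Bool) :
    lgW E lam qp qm 0 K b Y = cxW lam qp qm (b 0) (fun p => Y (E 0 p.1, p.2)) ^ K := by
  unfold lgW pairW
  simp

/-- **`stub_energy`(ii) is false without its sector hypothesis.**  Switch the pair coupling off (`κ₁ = 0`): for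
EVERY `0 < λ`, `q⁻ < q⁺ < 1` (the stub's `0 < q⁻` is not needed) and `K ≥ 1`, the sector optimisation fails already
for ONE variable and ONE equation `x + x + x = 0` (occurrence bound `D = 3`, right-hand side `b = 0`, `t = 0`, so
the occurrence and farness hypotheses hold trivially): the all-`−` phase vector weighs `F_max^K`, the reference
vector `F₀^K`, and `F₀ < F_max` (`cxW_ref_lt_allMinus`).  Any proof of the stub must therefore spend
`K·D·log ρ_F ≤ κ₁·log B`. -/
theorem sectorOpt_false_without_coupling {lam qp qm : ℝ} (hlam : 0 < lam) (hlt : qm < qp) (hqp : qp < 1)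
    {K : ℕ} (hK : 1 ≤ K) :
    ¬ ∀ (nv m D : ℕ) (E : Fin m → Fin 3 → Fin nv),
      (∀ x : Fin nv, (Finset.univ.filter fun p : Fin m × Fin 3 => E p.1 p.2 = x).card ≤ D) →
      ∀ (b : Fin m → ZMod 2) (t : ℕ),
        (∀ f : Fin nv → ZMod 2,
          t ≤ (Finset.univ.filter fun e : Fin m => ∑ i : Fin 3, f (E e i) ≠ b e).card) →
        ∀ Y : Fin nv × ZMod 2 → Bool,
          lgW E lam qp qm 0 K b Y * Real.exp (K * t * (pwPsi lam qp qm 0 - pwPsi lam qp qm 1)) ≤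
            lgW E lam qp qm 0 K 0 lgRef := by
  intro h
  have key := h 1 1 3 (fun _ _ => 0) (fun x => (Finset.card_filter_le _ _).trans (by simp)) 0 0
    (fun f => Nat.zero_le _) (fun _ => false)
  rw [lgW_one_one_zero_coupling, lgW_one_one_zero_coupling] at key
  simp only [Nat.cast_zero, mul_zero, zero_mul, Real.exp_zero, mul_one, Pi.zero_apply, lgRef] at key
  have hlt' := cxW_ref_lt_allMinus hlam hlt hqp
  have hpos : 0 ≤ cxW lam qp qm 0 (fun p => decide (p.2 = 0)) :=
    (cxW_pos hlam.le (hlt.le.trans hqp.le) hqp.le 0 _).le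
  have hpow := pow_lt_pow_left₀ hlt' hpos (by omega : K ≠ 0)
  exact absurd key (not_le.2 hpow)

/-- With no pair coupling the weight of a phase vector is the product of the `K`-th powers of the complex factors,
for ANY system. -/
theorem lgW_zero_coupling {nv m : ℕ} (E : Fin m → Fin 3 → Fin nv) (lam qp qm : ℝ) (K : ℕ) (b : Fin m → ZMod 2)
    (Y : Fin nv × ZMod 2 → Bool) :
    lgW E lam qp qm 0 K b Y = ∏ e : Fin m, cxW lam qp qm (b e) (fun p => Y (E e p.1, p.2)) ^ K := by
  unfold lgW pairW
  simp

/-- **For EVERY system with at least one equation, the reference vector is NOT the heaviest once the pair coupling is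
off** (`κ₁ = 0`, `K ≥ 1`, right-hand side `0`): the all-`−` vector is strictly heavier, factor by factor
(`cxW_ref_lt_allMinus`; the reference pattern read by ANY equation is `(i,a) ↦ [a = 0]`, whatever its variables). -/
theorem lgW_ref_lt_allMinus_zero_coupling {lam qp qm : ℝ} (hlam : 0 < lam) (hlt : qm < qp) (hqp : qp < 1)
    {nv m : ℕ} (hm : 0 < m) (E : Fin m → Fin 3 → Fin nv) {K : ℕ} (hK : 1 ≤ K) :
    lgW E lam qp qm 0 K 0 lgRef < lgW E lam qp qm 0 K 0 (fun _ => false) := by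
  rw [lgW_zero_coupling, lgW_zero_coupling]
  simp only [Pi.zero_apply, lgRef]
  have hpos : ∀ y : Fin 3 × ZMod 2 → Bool, 0 < cxW lam qp qm 0 y := fun y =>
    cxW_pos hlam.le (hlt.le.trans hqp.le) hqp.le 0 y
  have hfac : cxW lam qp qm 0 (fun p : Fin 3 × ZMod 2 => decide (p.2 = 0)) ^ K <
      cxW lam qp qm 0 (fun _ => false) ^ K :=
    pow_lt_pow_left₀ (cxW_ref_lt_allMinus hlam hlt hqp) (hpos _).le (by omega : K ≠ 0)
  exact Finset.prod_lt_prod (fun e _ => pow_pos (hpos _) K) (fun e _ => hfac.le) ⟨⟨0, hm⟩, Finset.mem_univ _, hfac⟩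

/-- Hence, for EVERY system with at least one equation (any `nv`, any `E`, injective rows or not), every
`0 < λ`, `q⁻ < q⁺ < 1` and `K ≥ 1`, the `κ₁ = 0` instance of `stub_energy` minus its sector hypothesis FAILS (take the
occurrence bound `D :=` the number of all occurrences, `b = 0`, `t = 0`, `Y ≡ −`). -/
theorem sectorOpt_false_without_coupling_any {lam qp qm : ℝ} (hlam : 0 < lam) (hlt : qm < qp) (hqp : qp < 1)
    {nv m : ℕ} (hm : 0 < m) (E : Fin m → Fin 3 → Fin nv) {K : ℕ} (hK : 1 ≤ K) :
    ¬ ∀ (D : ℕ), (∀ x : Fin nv, (Finset.univ.filter fun p : Fin m × Fin 3 => E p.1 p.2 = x).card ≤ D) →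
      ∀ (b : Fin m → ZMod 2) (t : ℕ),
        (∀ f : Fin nv → ZMod 2,
          t ≤ (Finset.univ.filter fun e : Fin m => ∑ i : Fin 3, f (E e i) ≠ b e).card) →
        ∀ Y : Fin nv × ZMod 2 → Bool,
          lgW E lam qp qm 0 K b Y * Real.exp (K * t * (pwPsi lam qp qm 0 - pwPsi lam qp qm 1)) ≤
            lgW E lam qp qm 0 K 0 lgRef := by
  intro h
  have key := h (Finset.univ : Finset (Fin m × Fin 3)).card (fun x => Finset.card_filter_le _ _) 0 0
    (fun f => Nat.zero_le _) (fun _ => false)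
  simp only [Nat.cast_zero, mul_zero, zero_mul, Real.exp_zero, mul_one] at key
  exact absurd key (not_le.2 (lgW_ref_lt_allMinus_zero_coupling hlam hlt hqp hm E hK))

/-- **The sector hypothesis cannot be dropped from `stub_energy`.** The negated statement is `stub_energy` of the
skeleton (stub set 5142eca0, = the landed `PhaseTwinsMacroscopicTwinsAboveEnergy`) with the SECTOR hypothesis
`hcouple : K·D·log ρ_F ≤ κ₁·log B` deleted and everything else verbatim (binders made explicit), universally closed
over its parameters; refuted at `λ = 1`, `q⁺ = 1/2`, `q⁻ = 1/4`, `K = 1`, `κ₁ = 0` by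
`sectorOpt_false_without_coupling`. (Stated inline, without naming the weakened proposition, so that this file
declares theorems only.) -/
theorem not_sectorOptWithoutCoupling :
    ¬ ∀ (lam qp qm : ℝ), 0 < lam → 0 < qm → qm < qp → qp < 1 →
      ∀ (nv m D K κ₁ : ℕ) (E : Fin m → Fin 3 → Fin nv),
        (∀ x : Fin nv, (Finset.univ.filter fun p : Fin m × Fin 3 => E p.1 p.2 = x).card ≤ D) →
        ∀ (b : Fin m → ZMod 2) (t : ℕ),
          (∀ f : Fin nv → ZMod 2,
            t ≤ (Finset.univ.filter fun e : Fin m => ∑ i : Fin 3, f (E e i) ≠ b e).card) →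
          ∀ Y : Fin nv × ZMod 2 → Bool,
            lgW E lam qp qm κ₁ K b Y * Real.exp (K * t * (pwPsi lam qp qm 0 - pwPsi lam qp qm 1)) ≤
              lgW E lam qp qm κ₁ K 0 lgRef := fun h =>
  sectorOpt_false_without_coupling (lam := 1) (qp := 1 / 2) (qm := 1 / 4) one_pos (by norm_num) (by norm_num)
    (K := 1) le_rfl
    (fun nv m D E hocc b t hfar Y => h 1 (1 / 2) (1 / 4) one_pos (by norm_num) (by norm_num) (by norm_num)
      nv m D 1 0 E hocc b t hfar Y)

end Summit.PneNP.PneNP.Theorems.MacroscopicTwinsAbove.Negative
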